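import Summits.CriticalPhenomena.SAWScalingLimit.Theses.SAWDefectDecoherence
import Summits.CriticalPhenomena.SAWScalingLimit.Theorems.SAWDevelopingMapObservableToSLERestrictionCocycle
import Summits.CriticalPhenomena.SAWScalingLimit.Theorems.SAWDefectDecoherenceObservableToSLERTwoPieceRestrictionLimitFloor
import Literature.Probability.RandomPlanarGeometry.HullSubdomainPullback
import Literature.Probability.RandomPlanarGeometry.ConformalRestrictionProofs
import Literature.Probability.RandomPlanarGeometry.ConformalRectangle
import Literature.Probability.RandomPlanarGeometry.RestrictionHulls
import HarnessLib

/-!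
# Crux `SAWDefectDecoherence.ObservableToSLER` (stmt-CriticalPhenomena-14005), line
`bridge-gate-renewal` (reshape r7), registered stub 5a2 `stub_twoPieceAdmRestrictionLimit`

Landing target:
`Summits/CriticalPhenomena/SAWScalingLimit/Theorems/SAWDefectDecoherenceObservableToSLERTwoPieceRestrictionLimit.lean`
(`--supports stmt-CriticalPhenomena-14005`).  The theorem statement below is the REGISTERED stub
signature verbatim (skeleton `Cruxes/ObservableToSLER/Lines/bridge_gate_renewal.lean`, r7):
`HexObservableLimitR → TwoPieceSourceLocality → TwoPieceAdmRestrictionLimit`, both typed statements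
inlined.

## What is proved

The TWO-PIECE ADMISSIBLE RESTRICTION LIMIT: crux 10472's `AdmissibleRestrictionLimit` (landed as
`FloorRatio.stub_restrictionCocycle`, `…SAWDevelopingMapObservableToSLERestrictionCocycle.lean`) with
the floor hypothesis `IsFloorDomain` replaced by flatness of `D` in the `ρ`-ball at EACH marked point
(different heights, no global floor), the single lattice threshold and the global floor clause
replaced by a COMMON free threshold `m₀ δ` in the ball at `pt 0` and SEPARATE free thresholds
`m₁ δ` (for `Λ`), `m₁' δ` (for `Λ'`) in the ball at `pt 1`, and the anchor `ShortChordLocality`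
replaced by the family-wise `TwoPieceSourceLocality` (the second hypothesis; an open lattice
estimate of the line, registered as stub 5a1).  Conclusion: for nested admissible families
`Λ' δ ⊆ Λ δ` of a hull subdomain `D' = φ(ℍ ∖ A) ⊆ D`, the exact lattice restriction probability
`Z_{Λ' δ}(a δ, b δ)/Z_{Λ δ}(a δ, b δ)` tends to `Φ_A'(0)^{5/8}` (Lawler–Schramm–Werner).

## Proof (the bootstrap of 10472, ported)

Write `Z_Λ(p, q) = Σ_{γ ⊂ Λ : p → q} x_c^{ℓ(γ)}` and `r_{pq} = Z_{Λ'}(p,q)/Z_Λ(p,q) ∈ [0, 1]`.  For a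
floor point `s = a + t` of the flat piece at `a = pt 0` and its lattice approximants `s_δ`
(`TwoPiece.twoPieceFloorData`, which uses only the LOCAL row clause at `pt 0`):
`r_{ab} = r_{as} · [Z_{Λ'}(a,b)/Z_{Λ'}(a,s)] · [Z_Λ(a,s)/Z_Λ(a,b)]`.  The two brackets are the moduli
of the ratios `F(s_δ)/F(b_δ)` of the parafermionic observable — by BOUNDARY WINDING RIGIDITY
(`TwoPiece.norm_observable_eq_archMass`, from the route's landed support item
`boundaryWindingRigidity_proof`: all walks between two boundary mid-edges of a simply connected
domain have the same winding), which replaces the global-floor strip-winding lemma of 10472 — and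
they converge by the landed target transport `FloorRatio.stub_targetTransport` (already two-piece:
local flatness at `pt 0`, `pt 1`, `s` and three free thresholds `m₀, m₁, m₀` resp. `m₀, m₁', m₀`;
its hypothesis `SAWDevelopingMap.HexObservableLimit` is syntactically `HexObservableLimitR`) applied
to `(D; a; b, s)` with `Λ` and to `(D'; a; b, s)` with `Λ'`, the conformal data
`Ψ = -1/φ⁻¹`, `Ψ' = -1/(Φ_A ∘ φ⁻¹)` coming from `FloorRatio.exists_conformalPackage` (local flatness
only).  Their quotient tends to `R(t) = exp((5/8)(Re(Ls - Lb) - Re(L's - L'b)))`, and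
`R(t) → Φ_A'(0)^{5/8}` as `t → 0⁺` (coalescence).  Two-piece source locality, applied in the ball
at `pt 0` to the family `Λ` with `ε = η`, gives `K, t₀`; for `0 < t < t₀` the far mass of the chords
`a δ → s_δ` beyond scaled distance `K t` is eventually `≤ η Z_Λ(a,s)`, while the near walks are walks
of `Λ'` (the two families agree in the ball at `pt 0`; `TwoPiece.archMass_le_archMass_add_farMass_mesh`),
so `1 - η ≤ r_{as} ≤ 1` eventually, and the squeeze `FloorRatio.tendsto_of_forall_squeeze` concludes.
Sources: LawlerSchrammWerner2003 (Thm 6.1, §2), LawlerSchrammWerner2004SAW (§3.4),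
DuminilCopinSmirnov2012 (Lemma 2, §4).
-/

noncomputable section

open scoped BigOperators Topology NNReal ENNReal Classical
open Filter Set MeasureTheory Metric
open Literature.Probability.LatticeModels (HexVertex hexGraph hexCenter Site)
open Literature.Probability.RandomPlanarGeometry
open Literature.Probability.RandomPlanarGeometry.SAW
open UpperHalfPlane (upperHalfPlaneSet)

namespace Summit.CriticalPhenomena.SAWScalingLimit.Theorems.ObservableToSLER.TwoPiece

open Summit.CriticalPhenomena.SAWScalingLimit.Theses.SAWDefectDecoherence (HexObservableLimitR)
open Summit.CriticalPhenomena.SAWScalingLimit.Theorems.ObservableToSLE.FloorRatio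
  (exists_conformalPackage flat_of_subset tendsto_of_forall_squeeze exists_remark
    stub_targetTransport norm_exp_five_eighths sum_pow_length_pos exists_injective_verts_eq
    archMass_mono)

/-- STUB 5a2 (r7) — `HexObservableLimitR → TwoPieceSourceLocality → TwoPieceAdmRestrictionLimit`:
the **two-piece admissible restriction limit**.  For a Dobrushin domain `D` flat (at possibly
different heights) in the `ρ`-balls at its two marked points, a hull subdomain `D' = φ(ℍ ∖ A)` with
restriction derivative `d = Φ_A'(0)`, and nested admissible families `Λ' δ ⊆ Λ δ` (exact upper
half-lattices with a common free threshold `m₀ δ` in the ball at `pt 0` and separate free thresholds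
`m₁ δ`, `m₁' δ` in the ball at `pt 1`), the exact lattice restriction probability converges to the
Lawler–Schramm–Werner value: `Z_{Λ' δ}(a δ, b δ)/Z_{Λ δ}(a δ, b δ) → Φ_A'(0)^{5/8}`.  Port of crux
10472's landed `FloorRatio.stub_restrictionCocycle` (see the module docstring for the bootstrap and
for what changes in the two-piece setting).
[cite: LawlerSchrammWerner2003Restriction, Thm. 6.1 (p. 23)] -/
theorem stub_twoPieceAdmRestrictionLimit :
    HexObservableLimitR →
    (∀ (E : DobrushinDomain) (ρ : ℝ) (Λ : ℝ → Finset HexVertex) (m₀ : ℝ → ℤ)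
      (a : ℝ → Sym2 HexVertex),
      0 < ρ → E.carrier ∩ ball (E.pt 0) ρ = {z : ℂ | (E.pt 0).im < z.im} ∩ ball (E.pt 0) ρ →
      (∀ᶠ δ : ℝ in 𝓝[>] 0, hexDomainSimplyConnected (Λ δ) ∧ a δ ∈ hexDomainBoundary (Λ δ) ∧
        (∀ v ∈ Λ δ, (δ : ℂ) * hexCenter v ∈ E.carrier) ∧
        (∀ v : HexVertex, (δ : ℂ) * hexCenter v ∈ ball (E.pt 0) ρ → (v ∈ Λ δ ↔ m₀ δ ≤ v.1 1))) →
      Tendsto (fun δ : ℝ => (δ : ℂ) * hexMidpoint (a δ)) (𝓝[>] 0) (𝓝 (E.pt 0)) →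
      ∀ ε : ℝ, 0 < ε → ∃ K : ℝ, 0 < K ∧ ∃ t₀ : ℝ, 0 < t₀ ∧
        ∀ (s : ℝ → Sym2 HexVertex) (t : ℝ), t ≠ 0 → |t| < t₀ →
          (∀ᶠ δ : ℝ in 𝓝[>] 0, s δ ∈ hexDomainBoundary (Λ δ) ∧
            (hexMidpoint (s δ)).im = (hexMidpoint (a δ)).im) →
          Tendsto (fun δ : ℝ => (δ : ℂ) * hexMidpoint (s δ)) (𝓝[>] 0) (𝓝 (E.pt 0 + t)) →
          ∀ᶠ δ : ℝ in 𝓝[>] 0,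
            (∑ γ : HexMidEdgeSAW (Λ δ) (a δ) (s δ),
                if ∃ v ∈ γ.verts, K * |t| ≤ dist ((δ : ℂ) * hexCenter v) ((δ : ℂ) * hexMidpoint (a δ))
                then hexCriticalFugacity ^ γ.length else 0) ≤
              ε * ∑ γ : HexMidEdgeSAW (Λ δ) (a δ) (s δ), hexCriticalFugacity ^ γ.length) →
    ∀ (D D' : DobrushinDomain) (ρ : ℝ) (φ : ConformalEquiv upperHalfPlaneSet D.carrier)
      (Φ : ConformalEquiv (upperHalfPlaneSet \ φ.pullbackHull D') upperHalfPlaneSet) (d : ℝ)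
      (Λ Λ' : ℝ → Finset HexVertex) (m₀ m₁ m₁' : ℝ → ℤ) (a b : ℝ → Sym2 HexVertex),
      (0 < ρ ∧ ∀ i : Fin 2, D.carrier ∩ ball (D.pt i) ρ = {z : ℂ | (D.pt i).im < z.im} ∩ ball (D.pt i) ρ) →
      D.IsHullSubdomain D' → D.IsChordalUniformizing φ →
      IsRestrictionMap (φ.pullbackHull D') Φ → HasRestrictionDeriv (φ.pullbackHull D') Φ d →
      (∀ᶠ δ : ℝ in 𝓝[>] 0,
        Λ' δ ⊆ Λ δ ∧ hexDomainSimplyConnected (Λ δ) ∧ hexDomainSimplyConnected (Λ' δ) ∧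
        (hexGraph.induce (↑(Λ δ) : Set HexVertex)).Preconnected ∧
        (hexGraph.induce (↑(Λ' δ) : Set HexVertex)).Preconnected ∧
        a δ ∈ hexDomainBoundary (Λ δ) ∧ b δ ∈ hexDomainBoundary (Λ δ) ∧
        a δ ∈ hexDomainBoundary (Λ' δ) ∧ b δ ∈ hexDomainBoundary (Λ' δ) ∧
        Nonempty (HexMidEdgeSAW (Λ' δ) (a δ) (b δ)) ∧
        (∀ v ∈ Λ δ, (δ : ℂ) * hexCenter v ∈ D.carrier) ∧
        (∀ v ∈ Λ' δ, (δ : ℂ) * hexCenter v ∈ D'.carrier) ∧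
        (∀ v : HexVertex, (δ : ℂ) * hexCenter v ∈ ball (D.pt 0) ρ →
          ((v ∈ Λ δ ↔ m₀ δ ≤ v.1 1) ∧ (v ∈ Λ' δ ↔ m₀ δ ≤ v.1 1))) ∧
        (∀ v : HexVertex, (δ : ℂ) * hexCenter v ∈ ball (D.pt 1) ρ →
          ((v ∈ Λ δ ↔ m₁ δ ≤ v.1 1) ∧ (v ∈ Λ' δ ↔ m₁' δ ≤ v.1 1)))) →
      (∀ K : Set ℂ, IsCompact K → K ⊆ D.carrier →
        ∀ᶠ δ : ℝ in 𝓝[>] 0, ∀ v : HexVertex, (δ : ℂ) * hexCenter v ∈ K → v ∈ Λ δ) →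
      (∀ K : Set ℂ, IsCompact K → K ⊆ D'.carrier →
        ∀ᶠ δ : ℝ in 𝓝[>] 0, ∀ v : HexVertex, (δ : ℂ) * hexCenter v ∈ K → v ∈ Λ' δ) →
      Tendsto (fun δ : ℝ => (δ : ℂ) * hexMidpoint (a δ)) (𝓝[>] 0) (𝓝 (D.pt 0)) →
      Tendsto (fun δ : ℝ => (δ : ℂ) * hexMidpoint (b δ)) (𝓝[>] 0) (𝓝 (D.pt 1)) →
      Tendsto (fun δ : ℝ =>
          (∑ γ : HexMidEdgeSAW (Λ' δ) (a δ) (b δ), hexCriticalFugacity ^ γ.length) /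
            (∑ γ : HexMidEdgeSAW (Λ δ) (a δ) (b δ), hexCriticalFugacity ^ γ.length)) (𝓝[>] 0)
        (𝓝 (d ^ ((5 : ℝ) / 8))) := by
  intro hO hSL D D' ρ φ Φ d Λ Λ' m₀ m₁ m₁' a b hfl hD' hφ hΦ hd hev hKΛ hKΛ' ha hb
  obtain ⟨hρ, hflat⟩ := hfl
  have hflat0 := hflat 0
  have hflat1 := hflat 1
  obtain ⟨Ψ, L, Lb, Ψ', L', L'b, ρ₁, R, hρ₁, hρ₁ρ, hΨinf, hΨb, hLc, hLe, hLb, hΨ'inf, hΨ'b, hL'c,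
    hL'e, hL'b, hflat0', hflat1', hfloor, hR⟩ :=
    exists_conformalPackage D D' ρ φ Φ d hρ hflat0 hflat1 hD' hφ hΦ hd
  -- two-piece source locality in the ball at `pt 0`, for the family `Λ`
  have hSLD := hSL D ρ Λ m₀ a hρ hflat0 (by
      filter_upwards [hev] with δ hevδ
      obtain ⟨-, hscΛ, -, -, -, haΛ, -, -, -, -, hΛD, -, hrows0, -⟩ := hevδ
      exact ⟨hscΛ, haΛ, hΛD, fun v hv => (hrows0 v hv).1⟩) ha
  refine tendsto_of_forall_squeeze fun η hη => ?_
  obtain ⟨K, hK, t₀, ht₀, hSLK⟩ := hSLD η hη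
  -- choice of the floor point `s = a + t`
  obtain ⟨t, ht0, htρ, htK, htt₀, htR⟩ : ∃ t : ℝ, 0 < t ∧ t < ρ₁ / 4 ∧ 8 * K * t < ρ₁ ∧ t < t₀ ∧
      |R t - d ^ ((5 : ℝ) / 8)| ≤ η := by
    have h1 : ∀ᶠ t in 𝓝[>] (0 : ℝ), t < ρ₁ / 4 := mem_nhdsWithin_of_mem_nhds (Iio_mem_nhds (by positivity))
    have h2 : ∀ᶠ t in 𝓝[>] (0 : ℝ), 8 * K * t < ρ₁ := by
      have hc : Tendsto (fun t : ℝ => 8 * K * t) (𝓝 0) (𝓝 (8 * K * 0)) :=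
        (continuous_const.mul continuous_id).tendsto 0
      rw [mul_zero] at hc
      exact mem_nhdsWithin_of_mem_nhds (hc (Iio_mem_nhds hρ₁))
    have h3 : ∀ᶠ t in 𝓝[>] (0 : ℝ), t < t₀ := mem_nhdsWithin_of_mem_nhds (Iio_mem_nhds ht₀)
    have h4 : ∀ᶠ t in 𝓝[>] (0 : ℝ), |R t - d ^ ((5 : ℝ) / 8)| ≤ η := by
      filter_upwards [Metric.tendsto_nhds.1 hR η hη] with t ht
      rw [Real.dist_eq] at ht
      exact ht.le
    obtain ⟨t, ⟨h1t, h2t, h3t, h4t⟩, ht0⟩ :=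
      ((h1.and (h2.and (h3.and h4))).and self_mem_nhdsWithin).exists
    exact ⟨t, ht0, h1t, h2t, h3t, h4t⟩
  obtain ⟨hsfr, hsfr', hsa, Ls, L's, hLs, hL's, hRt⟩ := hfloor t ht0 (by linarith)
  set s : ℂ := D.pt 0 + t with hs
  have hsim : s.im = (D.pt 0).im := by simp [hs]
  have hdist_s : dist s (D.pt 0) = t := by
    rw [hs, dist_eq_norm, add_sub_cancel_left, Complex.norm_real, Real.norm_eq_abs, abs_of_pos ht0]
  have htabs : |t| = t := abs_of_pos ht0
  have hKt : 2 * (K * |t|) < ρ := by rw [htabs]; nlinarith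
  -- the local lattice floor data at `pt 0`
  obtain ⟨sE, hsE, hevF⟩ := twoPieceFloorData (p := D.pt 0) Λ Λ' m₀ a hρ
    (by
      filter_upwards [hev] with δ hevδ
      obtain ⟨-, -, -, hconn, hconn', haΛ, -, -, -, -, -, -, hrows0, -⟩ := hevδ
      exact ⟨hconn, hconn', haΛ, hrows0⟩)
    ha hsa hsim (by rw [hdist_s]; linarith) hKt
  -- re-marked domains `(D; a, s)`, `(D'; a, s)`
  obtain ⟨Ds, hDs_car, hDs0, hDs1⟩ := exists_remark D hsfr hsa
  obtain ⟨D's, hD's_car, hD's0, hD's1⟩ := exists_remark D' hsfr' (by rw [hD'.pt_zero_eq]; exact hsa)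
  -- the transport radius `ρ₂ = ρ₁/2` and flatness
  have hballs : ball s (ρ₁ / 2) ⊆ ball (D.pt 0) ρ₁ := by
    intro z hz
    rw [mem_ball] at hz ⊢
    calc dist z (D.pt 0) ≤ dist z s + dist s (D.pt 0) := dist_triangle _ _ _
      _ < ρ₁ / 2 + t := by rw [hdist_s]; linarith
      _ ≤ ρ₁ := by linarith
  have hballsρ : ball s (ρ₁ / 2) ⊆ ball (D.pt 0) ρ := hballs.trans (ball_subset_ball hρ₁ρ)
  have hρ₂ρ : ρ₁ / 2 ≤ ρ := by linarith
  have hf0 := flat_of_subset hflat0 (ball_subset_ball hρ₂ρ) rfl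
  have hf1 := flat_of_subset hflat1 (ball_subset_ball hρ₂ρ) rfl
  have hfs := flat_of_subset hflat0 hballsρ hsim
  have hf0' := flat_of_subset hflat0' (ball_subset_ball (by linarith : ρ₁ / 2 ≤ ρ₁)) rfl
  have hf1' := flat_of_subset hflat1' (ball_subset_ball (by linarith : ρ₁ / 2 ≤ ρ₁)) rfl
  have hfs' := flat_of_subset hflat0' hballs hsim
  -- nonempty walk spaces `a δ → b δ` in `Λ δ`
  have hevN : ∀ᶠ δ : ℝ in 𝓝[>] 0, Nonempty (HexMidEdgeSAW (Λ δ) (a δ) (b δ)) := by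
    filter_upwards [hev] with δ hevδ
    obtain ⟨hsubΛ, -, -, -, -, -, -, -, -, hne', -⟩ := hevδ
    obtain ⟨ι, -, -⟩ := exists_injective_verts_eq hsubΛ (a δ) (b δ)
    exact hne'.map ι
  -- target transport in `(D; a; b, s)` with `Λ`
  have T₁ : Tendsto (fun δ : ℝ =>
      hexParafermionicObservable (Λ δ) (a δ) hexCriticalFugacity (5 / 8) (sE δ) /
        hexParafermionicObservable (Λ δ) (a δ) hexCriticalFugacity (5 / 8) (b δ)) (𝓝[>] 0)
      (𝓝 (Complex.exp ((5 / 8 : ℂ) * (Ls - Lb)))) := by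
    refine stub_targetTransport hO D Ds (ρ₁ / 2) Λ m₀ m₁ m₀ a b sE Ψ L Lb Ls hDs_car hDs0
      (half_pos hρ₁) hf0 hf1 (by rw [hDs1]; exact hfs) ?_ hKΛ ha hb (by rw [hDs1]; exact hsE)
      hΨinf hΨb hLc hLe hLb (by rw [hDs1]; exact hLs)
    filter_upwards [hev, hevF, hevN] with δ hevδ hF hne_ab
    obtain ⟨-, hscΛ, -, hconn, -, haΛ, hbΛ, -, -, -, hΛD, -, hrows0, hrows1⟩ := hevδ
    obtain ⟨hsEbd, -, hne_as, -, -, -⟩ := hF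
    refine ⟨hscΛ, haΛ, hbΛ, hsEbd, hne_ab, hne_as, hconn, hΛD, ?_, ?_, ?_⟩
    · exact fun v hv => (hrows0 v (ball_subset_ball hρ₂ρ hv)).1
    · exact fun v hv => (hrows1 v (ball_subset_ball hρ₂ρ hv)).1
    · intro v hv
      rw [hDs1] at hv
      exact (hrows0 v (hballsρ hv)).1
  -- target transport in `(D'; a; b, s)` with `Λ'`
  have T₂ : Tendsto (fun δ : ℝ =>
      hexParafermionicObservable (Λ' δ) (a δ) hexCriticalFugacity (5 / 8) (sE δ) /
        hexParafermionicObservable (Λ' δ) (a δ) hexCriticalFugacity (5 / 8) (b δ)) (𝓝[>] 0)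
      (𝓝 (Complex.exp ((5 / 8 : ℂ) * (L's - L'b)))) := by
    refine stub_targetTransport hO D' D's (ρ₁ / 2) Λ' m₀ m₁' m₀ a b sE Ψ' L' L'b L's hD's_car hD's0
      (half_pos hρ₁) (by rw [hD'.pt_zero_eq]; exact hf0') (by rw [hD'.pt_one_eq]; exact hf1')
      (by rw [hD's1]; exact hfs') ?_ hKΛ' (by rw [hD'.pt_zero_eq]; exact ha)
      (by rw [hD'.pt_one_eq]; exact hb) (by rw [hD's1]; exact hsE)
      (by rw [hD'.pt_zero_eq]; exact hΨ'inf) (by rw [hD'.pt_one_eq]; exact hΨ'b) hL'c hL'e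
      (by rw [hD'.pt_one_eq]; exact hL'b) (by rw [hD's1]; exact hL's)
    filter_upwards [hev, hevF] with δ hevδ hF
    obtain ⟨-, -, hscΛ', -, hconn', -, -, haΛ', hbΛ', hne', -, hΛ'D', hrows0, hrows1⟩ := hevδ
    obtain ⟨-, hsEbd', -, hne_as', -, -⟩ := hF
    refine ⟨hscΛ', haΛ', hbΛ', hsEbd', hne', hne_as', hconn', hΛ'D', ?_, ?_, ?_⟩
    · intro v hv
      rw [hD'.pt_zero_eq] at hv
      exact (hrows0 v (ball_subset_ball hρ₂ρ hv)).2
    · intro v hv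
      rw [hD'.pt_one_eq] at hv
      exact (hrows1 v (ball_subset_ball hρ₂ρ hv)).2
    · intro v hv
      rw [hD's1] at hv
      exact (hrows0 v (hballsρ hv)).2
  -- the far mass of the chords `a δ → s_δ` beyond `K t` is small (two-piece source locality)
  have hfar := hSLK sE t ht0.ne' (by rw [htabs]; exact htt₀)
    (hevF.mono fun δ hF => ⟨hF.1, hF.2.2.2.2.1⟩) hsE
  -- the squeeze data: `r = Z'(a,s)/Z(a,s)`, `Q = [Z'(a,b)/Z'(a,s)] · [Z(a,s)/Z(a,b)]`, `R = R t`
  refine ⟨fun δ => (∑ γ : HexMidEdgeSAW (Λ' δ) (a δ) (sE δ), hexCriticalFugacity ^ γ.length) /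
      (∑ γ : HexMidEdgeSAW (Λ δ) (a δ) (sE δ), hexCriticalFugacity ^ γ.length),
    fun δ => ((∑ γ : HexMidEdgeSAW (Λ' δ) (a δ) (b δ), hexCriticalFugacity ^ γ.length) /
      (∑ γ : HexMidEdgeSAW (Λ' δ) (a δ) (sE δ), hexCriticalFugacity ^ γ.length)) *
      ((∑ γ : HexMidEdgeSAW (Λ δ) (a δ) (sE δ), hexCriticalFugacity ^ γ.length) /
      (∑ γ : HexMidEdgeSAW (Λ δ) (a δ) (b δ), hexCriticalFugacity ^ γ.length)),
    R t, htR, ?_, ?_⟩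
  · -- `Q → R t`: `Q` is the quotient of the moduli of the two transported ratios
    have hA₂ : ‖Complex.exp ((5 / 8 : ℂ) * (L's - L'b))‖ ≠ 0 := norm_ne_zero_iff.2 (Complex.exp_ne_zero _)
    have hlim := (T₁.norm).div (T₂.norm) hA₂
    have hval : ‖Complex.exp ((5 / 8 : ℂ) * (Ls - Lb))‖ / ‖Complex.exp ((5 / 8 : ℂ) * (L's - L'b))‖ = R t := by
      rw [norm_exp_five_eighths, norm_exp_five_eighths, ← Real.exp_sub, ← hRt]
      congr 1
      ring
    rw [hval] at hlim
    refine hlim.congr' ?_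
    filter_upwards [hev, hevF] with δ hevδ hF
    obtain ⟨-, hscΛ, hscΛ', -, -, haΛ, hbΛ, haΛ', hbΛ', -, -⟩ := hevδ
    obtain ⟨hsEbd, hsEbd', hne_as, hne_as', -, -⟩ := hF
    have h1 := norm_observable_eq_archMass hscΛ haΛ hsEbd (5 / 8)
    have h2 := norm_observable_eq_archMass hscΛ haΛ hbΛ (5 / 8)
    have h3 := norm_observable_eq_archMass hscΛ' haΛ' hsEbd' (5 / 8)
    have h4 := norm_observable_eq_archMass hscΛ' haΛ' hbΛ' (5 / 8)
    have hpos1 := sum_pow_length_pos hne_as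
    have hpos2 := sum_pow_length_pos hne_as'
    simp only [Pi.div_apply, norm_div]
    rw [h1, h2, h3, h4]
    field_simp
  · -- eventually: `f = r · Q` and `1 - η ≤ r ≤ 1`
    filter_upwards [hev, hevF, hevN, hfar, self_mem_nhdsWithin] with δ hevδ hF hne_ab hfarδ hδ
    obtain ⟨hsubΛ, -, -, -, -, haΛ, -, haΛ', -⟩ := hevδ
    obtain ⟨hsEbd, -, hne_as, hne_as', -, hnear⟩ := hF
    have hZpos := sum_pow_length_pos hne_as
    have hZ'pos := sum_pow_length_pos hne_as'
    have hZab := sum_pow_length_pos hne_ab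
    refine ⟨?_, ?_, ?_⟩
    · field_simp
    · -- source locality: the far mass is small, the near walks live in `Λ'`
      have hsplit := archMass_le_archMass_add_farMass_mesh (t := sE δ) (R := K * |t|) hδ
        (hexDomainBoundary_subset _ haΛ') hnear
      rw [le_div_iff₀ hZpos]
      linarith
    · exact (div_le_one hZpos).2 (archMass_mono hsubΛ (a δ) (sE δ))

end Summit.CriticalPhenomena.SAWScalingLimit.Theorems.ObservableToSLER.TwoPiece

end
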